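import Summits.CriticalPhenomena.PercolationContinuityZ3.Theorems.PercNearOneGluingAdditiveGluingSetObserverProjection
import Literature.Probability.Percolation.ConditionalPositiveAssociationProofs
import HarnessLib

/-!
# Conjecture G / SET-W via a SET observer, XI: the base case of the two-source inequality (A2^H) for an observer SET

Support file (`--supports stmt-CriticalPhenomena-4576`); no definitions, no named facts, no sorries.  Seat (b) V⁺-form `png-dp-vplus`, gen 12
(memo MEMO-gen12.md §4(d), §12 of run/shared/lean/prim/prim-png-dp-vplus/).

The averaged observer-constant correction (Htw) of prim-hp-8's conditioned slack hierarchy comes from the two-source inequality A2^H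
(`CovTau.a2H`, META-A2 with the pure world functional `e(W) = μ_{G∖W}(o ∈ C_v, v ↮ S)`).  For the SET-observer hierarchy (…CSHSetDefs.lean) the
e-functional is `e_set(W) = 1{O ∩ W = ∅}·μ_{G∖W}(O ~ v, O ≁ S)` (the observer set is killed when it meets the deleted world); its two META-A2
inputs are monotonicity in the source set (immediate: `⟨e_set⟩_N = μ(O~v, O≁S∪N)`) and the disjoint-sources base case, which is THIS file:
* `setObs_twoSource_base` — for a marker set `S ∌ v`, source sets `N, N'` and an observer set `O`:
  `μ({O~v} ∩ {O ≁ S ∪ N}) · μ(v ↮ S ∪ N′) ≤ μ({O~v} ∩ {O ≁ S}) · μ(v ↮ S ∪ N ∪ N′)`.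
  Proof (memo §4(d)): project the observer indicator `1{O~v}1{O≁S}` onto `σ(C_v)` — `γ(K) = 1{O ∩ V(K) ≠ ∅}·μ_{off K̄}(O ∖ V(K) ≁ S)`, an INCREASING
  function of the edge cluster of `v` (Markov at `C_v`, `BHK2006.set_sum_cond_cluster`) — and use vdBHK's Theorem 1.3 for `C_v` given `v ↮ S` twice
  (`γ` increasing against `1{v↮N}` decreasing; `1{v↮N}`, `1{v↮N′}` both decreasing).
[cite: VandenbergHaggstromKahn2005, Thm. 1.3 (p. 6), §2.1 Lemma 2.4 (p. 10)] [cite: KozmaNitzan2024, Conj. 4 (p. 32)]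
-/

noncomputable section

namespace Summit.CriticalPhenomena.PercolationContinuityZ3.Theorems

open MeasureTheory Set Literature.Probability.LatticeModels Literature.Probability.Percolation
open Literature.Probability.Percolation.KNPreFKG Literature.Probability.Percolation.BHK2006 Literature.Probability.Percolation.DecisionTree
open scoped Classical

namespace SetSurplus

variable {V : Type*} [Fintype V]

/-- **Projection of the set-observer indicator onto the cluster of `v`** (Markov at `C_v`, vdBHK Lemma 2.4): for every function `h` of the open
edge cluster of `v` and `D = {v ↮ S}`,
`∫_D 1{O~v}·1{O≁S}·h(C_v) dμ = ∫_D γ(C_v)·h(C_v) dμ`, `γ(K) = 1{∃ o ∈ O, o ∈ V_v(K)} · E_η[1{no o ∈ O outside V_v(K) reaches S in η ∖ K̄}]`.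
[cite: VandenbergHaggstromKahn2005, §2.1 Lemma 2.4 (p. 10)] -/
theorem setIntegral_obs_mul_eq_proj (w : Sym2 V → unitInterval) (S O : Finset V) (v : V) (h : Set (Sym2 V) → ℝ) :
    ∫ ω in {ω : BondConfig V | ∀ t ∈ S, ¬ (openGraph ω).Reachable v t},
        (({ω : BondConfig V | ∃ o ∈ O, (openGraph ω).Reachable o v} ∩
          {ω | ∀ o ∈ O, ∀ t ∈ S, ¬ (openGraph ω).Reachable o t}).indicator (1 : BondConfig V → ℝ) ω) * h (openEdgeCluster ω v)
        ∂(prodBernoulli w) =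
      ∫ ω in {ω : BondConfig V | ∀ t ∈ S, ¬ (openGraph ω).Reachable v t},
        ((if (∃ o ∈ O, o = v ∨ ∃ e ∈ openEdgeCluster ω v, o ∈ e) then (1 : ℝ) else 0) *
          (∫ η, (if (∀ o ∈ O, ¬ (o = v ∨ ∃ e ∈ openEdgeCluster ω v, o ∈ e) →
              ∀ t ∈ S, ¬ (openGraph (η \ barOf {v} (openEdgeCluster ω v))).Reachable o t) then (1 : ℝ) else 0) ∂(prodBernoulli w))) *
          h (openEdgeCluster ω v) ∂(prodBernoulli w) := by
  classical
  set μ := prodBernoulli w with hμ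
  set w' : Sym2 V → ℝ := fun e => ((w e : unitInterval) : ℝ) with hw'
  have hm : ∑ ω : Set (Sym2 V), weight w' ω = 1 := by
    have h1 := integral_prodBernoulli_eq_sum w fun _ => (1 : ℝ)
    simp only [integral_const, probReal_univ, smul_eq_mul, mul_one] at h1
    exact h1.symm
  set D : Set (BondConfig V) := {ω | ∀ t ∈ S, ¬ (openGraph ω).Reachable v t} with hD
  have hDiff : ∀ ω : BondConfig V, ω ∈ D ↔ ∀ s ∈ ({v} : Set V), ∀ t ∈ (↑S : Set V), ¬ (openGraph ω).Reachable s t := by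
    intro ω; simp [hD]
  set E : Set (BondConfig V) := {ω : BondConfig V | ∃ o ∈ O, (openGraph ω).Reachable o v} ∩
    {ω | ∀ o ∈ O, ∀ t ∈ S, ¬ (openGraph ω).Reachable o t} with hE
  let touchK : Set (Sym2 V) → Prop := fun K => ∃ o ∈ O, o = v ∨ ∃ e ∈ K, o ∈ e
  let avoidL : Set (Sym2 V) → Set (Sym2 V) → Prop := fun K L =>
    ∀ o ∈ O, ¬ (o = v ∨ ∃ e ∈ K, o ∈ e) → ∀ t ∈ S, ¬ (o = t ∨ ∃ e ∈ openEdgeCluster L t, o ∈ e)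
  set H : Set (Sym2 V) → Set (Sym2 V) → ℝ := fun K L => (if touchK K ∧ avoidL K L then 1 else 0) * h K with hH
  have key := set_sum_cond_cluster w' hm ({v} : Set V) (↑S : Set V) H hDiff
  simp only [setCl_singleton] at key
  -- the event on `D`
  have hev : ∀ ω : BondConfig V, ω ∈ D → ((touchK (openEdgeCluster ω v) ∧ avoidL (openEdgeCluster ω v) (setCl ω ↑S)) ↔ ω ∈ E) := by
    intro ω hωD
    constructor
    · rintro ⟨⟨o, ho, hto⟩, hav⟩
      refine ⟨⟨o, ho, ((reachable_iff_exists_mem_openEdgeCluster ω v o).2 hto).symm⟩, fun o' ho' t ht hot => ?_⟩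
      by_cases hin : o' = v ∨ ∃ e ∈ openEdgeCluster ω v, o' ∈ e
      · exact hωD t ht (((reachable_iff_exists_mem_openEdgeCluster ω v o').2 hin).trans hot)
      · refine hav o' ho' hin t ht ?_
        have := (reachable_iff_exists_mem_openEdgeCluster ω t o').1 hot.symm
        simp only [setCl]
        rwa [CovTauStarN.openEdgeCluster_biUnion_eq (Finset.mem_coe.2 ht)]
    · rintro ⟨⟨o, ho, hov⟩, hav⟩
      refine ⟨⟨o, ho, (reachable_iff_exists_mem_openEdgeCluster ω v o).1 hov.symm⟩, fun o' ho' _ t ht h' => ?_⟩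
      simp only [setCl] at h'
      rw [CovTauStarN.openEdgeCluster_biUnion_eq (Finset.mem_coe.2 ht)] at h'
      exact hav o' ho' t ht ((reachable_iff_exists_mem_openEdgeCluster ω t o').2 h').symm
  -- reading the world avoidance through the edge cluster of `S` in the world
  have havW : ∀ (K : Set (Sym2 V)) (η : Set (Sym2 V)),
      avoidL K (setCl (η \ barOf {v} K) ↑S) ↔
        (∀ o ∈ O, ¬ (o = v ∨ ∃ e ∈ K, o ∈ e) → ∀ t ∈ S, ¬ (openGraph (η \ barOf {v} K)).Reachable o t) := by
    intro K η
    refine forall₂_congr fun o _ => forall_congr' fun _ => forall₂_congr fun t ht => ?_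
    simp only [setCl]
    rw [CovTauStarN.openEdgeCluster_biUnion_eq (Finset.mem_coe.2 ht), ← reachable_iff_exists_mem_openEdgeCluster]
    exact ⟨fun h1 h2 => h1 h2.symm, fun h1 h2 => h1 h2.symm⟩
  rw [← integral_indicator (MeasurableSet.of_discrete), ← integral_indicator (MeasurableSet.of_discrete),
    integral_prodBernoulli_eq_sum, integral_prodBernoulli_eq_sum]
  have hL : ∀ ω : BondConfig V, weight w' ω * (H (openEdgeCluster ω v) (setCl ω ↑S) * ind D ω) =
      weight w' ω * D.indicator (fun ω => (E.indicator (1 : BondConfig V → ℝ) ω) * h (openEdgeCluster ω v)) ω := by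
    intro ω
    by_cases hωD : ω ∈ D
    · rw [ind_of_mem hωD, mul_one, indicator_of_mem hωD]
      simp only [hH]
      by_cases hωE : ω ∈ E
      · rw [if_pos ((hev ω hωD).2 hωE), indicator_of_mem hωE, Pi.one_apply]
      · rw [if_neg (fun h' => hωE ((hev ω hωD).1 h')), indicator_of_notMem hωE]
    · rw [ind_of_not_mem hωD, mul_zero, indicator_of_notMem hωD]
  have hR : ∀ ω : BondConfig V, weight w' ω * ((∑ η, weight w' η * H (openEdgeCluster ω v) (setCl (η \ barOf {v} (openEdgeCluster ω v)) ↑S)) * ind D ω) =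
      weight w' ω * D.indicator (fun ω => ((if (∃ o ∈ O, o = v ∨ ∃ e ∈ openEdgeCluster ω v, o ∈ e) then (1 : ℝ) else 0) *
          (∫ η, (if (∀ o ∈ O, ¬ (o = v ∨ ∃ e ∈ openEdgeCluster ω v, o ∈ e) →
              ∀ t ∈ S, ¬ (openGraph (η \ barOf {v} (openEdgeCluster ω v))).Reachable o t) then (1 : ℝ) else 0) ∂μ)) *
          h (openEdgeCluster ω v)) ω := by
    intro ω
    by_cases hωD : ω ∈ D
    · rw [ind_of_mem hωD, mul_one, indicator_of_mem hωD, integral_prodBernoulli_eq_sum]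
      congr 1
      simp only [hH]
      by_cases ht : touchK (openEdgeCluster ω v)
      · rw [if_pos ht, one_mul, Finset.sum_mul]
        refine Finset.sum_congr rfl fun η _ => ?_
        by_cases ha : avoidL (openEdgeCluster ω v) (setCl (η \ barOf {v} (openEdgeCluster ω v)) ↑S)
        · have e1 : (if (touchK (openEdgeCluster ω v) ∧ avoidL (openEdgeCluster ω v) (setCl (η \ barOf {v} (openEdgeCluster ω v)) ↑S))
              then (1 : ℝ) else 0) = 1 := if_pos (And.intro ht ha)
          have e2 : (if (∀ o ∈ O, ¬ (o = v ∨ ∃ e ∈ openEdgeCluster ω v, o ∈ e) →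
              ∀ t ∈ S, ¬ (openGraph (η \ barOf {v} (openEdgeCluster ω v))).Reachable o t) then (1 : ℝ) else 0) = 1 :=
            if_pos ((havW _ η).1 ha)
          simp only [e1, e2, mul_one, one_mul]
          rfl
        · have e1 : (if (touchK (openEdgeCluster ω v) ∧ avoidL (openEdgeCluster ω v) (setCl (η \ barOf {v} (openEdgeCluster ω v)) ↑S))
              then (1 : ℝ) else 0) = 0 := if_neg (fun h' => ha h'.2)
          have e2 : (if (∀ o ∈ O, ¬ (o = v ∨ ∃ e ∈ openEdgeCluster ω v, o ∈ e) →
              ∀ t ∈ S, ¬ (openGraph (η \ barOf {v} (openEdgeCluster ω v))).Reachable o t) then (1 : ℝ) else 0) = 0 :=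
            if_neg (fun h' => ha ((havW _ η).2 h'))
          simp only [e1, e2, zero_mul, mul_zero]
      · rw [if_neg ht, zero_mul, zero_mul]
        have : ∀ η : Set (Sym2 V), weight w' η * ((if touchK (openEdgeCluster ω v) ∧ avoidL (openEdgeCluster ω v)
            (setCl (η \ barOf {v} (openEdgeCluster ω v)) ↑S) then (1 : ℝ) else 0) * h (openEdgeCluster ω v)) = 0 := fun η => by
          rw [if_neg (fun h' => ht h'.1), zero_mul, mul_zero]
        simp only [this, Finset.sum_const_zero]
    · rw [ind_of_not_mem hωD, mul_zero, indicator_of_notMem hωD]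
  rw [Finset.sum_congr rfl fun ω _ => (hL ω).symm, key]
  exact Finset.sum_congr rfl fun ω _ => hR ω

/-- **The base case of the set-observer two-source inequality** (input (ii) of META-A2 for the killed-observer e-functional; memo §4(d)):
for a marker set `S` with `v ∉ S`, source sets `N, N′` and an observer set `O`,
`μ({O~v} ∩ {O ≁ S ∪ N}) · μ(v ↮ S ∪ N′) ≤ μ({O~v} ∩ {O ≁ S}) · μ(v ↮ S ∪ N ∪ N′)`.
[cite: VandenbergHaggstromKahn2005, Thm. 1.3 (p. 6), §2.1 Lemma 2.4 (p. 10)] -/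
theorem setObs_twoSource_base (w : Sym2 V → unitInterval) (S N N' O : Finset V) (v : V) (hvS : v ∉ S) :
    (prodBernoulli w).real ({ω : BondConfig V | ∃ o ∈ O, (openGraph ω).Reachable o v} ∩
        {ω | ∀ o ∈ O, ∀ t ∈ S ∪ N, ¬ (openGraph ω).Reachable o t}) *
      (prodBernoulli w).real {ω : BondConfig V | ∀ t ∈ S ∪ N', ¬ (openGraph ω).Reachable v t} ≤
    (prodBernoulli w).real ({ω : BondConfig V | ∃ o ∈ O, (openGraph ω).Reachable o v} ∩
        {ω | ∀ o ∈ O, ∀ t ∈ S, ¬ (openGraph ω).Reachable o t}) *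
      (prodBernoulli w).real {ω : BondConfig V | ∀ t ∈ S ∪ N ∪ N', ¬ (openGraph ω).Reachable v t} := by
  classical
  set μ := prodBernoulli w with hμ
  have hmeas : ∀ T : Set (BondConfig V), MeasurableSet T := fun _ => MeasurableSet.of_discrete
  have hn := fun (T : Set (BondConfig V)) => (measureReal_nonneg : 0 ≤ μ.real T)
  set D : Set (BondConfig V) := {ω : BondConfig V | ∀ t ∈ S, ¬ (openGraph ω).Reachable v t} with hD
  have hDX : D = {ω : BondConfig V | ∀ x ∈ (↑S : Set V), ¬ (openGraph ω).Reachable v x} := by ext ω; simp [hD]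
  set E : Set (BondConfig V) := {ω : BondConfig V | ∃ o ∈ O, (openGraph ω).Reachable o v} ∩
    {ω | ∀ o ∈ O, ∀ t ∈ S, ¬ (openGraph ω).Reachable o t} with hE
  set EN : Set (BondConfig V) := {ω : BondConfig V | ∃ o ∈ O, (openGraph ω).Reachable o v} ∩
    {ω | ∀ o ∈ O, ∀ t ∈ S ∪ N, ¬ (openGraph ω).Reachable o t} with hEN
  -- the projected indicator `γ` and the avoidance indicators as functions of the edge cluster of `v`
  set γ : Set (Sym2 V) → ℝ := fun K => (if (∃ o ∈ O, o = v ∨ ∃ e ∈ K, o ∈ e) then (1 : ℝ) else 0) *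
    (∫ η, (if (∀ o ∈ O, ¬ (o = v ∨ ∃ e ∈ K, o ∈ e) → ∀ t ∈ S, ¬ (openGraph (η \ barOf {v} K)).Reachable o t)
      then (1 : ℝ) else 0) ∂μ) with hγ
  set f1 : Set (Sym2 V) → ℝ := fun K => if (∀ n ∈ N, ¬ (n = v ∨ ∃ e ∈ K, n ∈ e)) then (1 : ℝ) else 0 with hf1
  set f2 : Set (Sym2 V) → ℝ := fun K => if (∀ n ∈ N', ¬ (n = v ∨ ∃ e ∈ K, n ∈ e)) then (1 : ℝ) else 0 with hf2
  have hγmono : Monotone γ := by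
    intro K K' hKK'
    simp only [hγ]
    have hq0 : ∀ L : Set (Sym2 V), 0 ≤ ∫ η, (if (∀ o ∈ O, ¬ (o = v ∨ ∃ e ∈ L, o ∈ e) →
        ∀ t ∈ S, ¬ (openGraph (η \ barOf {v} L)).Reachable o t) then (1 : ℝ) else 0) ∂μ :=
      fun L => integral_nonneg fun η => by positivity
    by_cases ht : ∃ o ∈ O, o = v ∨ ∃ e ∈ K, o ∈ e
    · have ht' : ∃ o ∈ O, o = v ∨ ∃ e ∈ K', o ∈ e := ht.imp fun o ho => ⟨ho.1, ho.2.imp id fun ⟨e, he, hoe⟩ => ⟨e, hKK' he, hoe⟩⟩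
      rw [if_pos ht, if_pos ht', one_mul, one_mul]
      refine integral_mono (Integrable.of_finite) (Integrable.of_finite) fun η => ?_
      by_cases ha : ∀ o ∈ O, ¬ (o = v ∨ ∃ e ∈ K, o ∈ e) → ∀ t ∈ S, ¬ (openGraph (η \ barOf {v} K)).Reachable o t
      · have ha' : ∀ o ∈ O, ¬ (o = v ∨ ∃ e ∈ K', o ∈ e) → ∀ t ∈ S, ¬ (openGraph (η \ barOf {v} K')).Reachable o t := by
          intro o ho hno t ht hr
          refine ha o ho (fun hin => hno (hin.imp id fun ⟨e, he, hoe⟩ => ⟨e, hKK' he, hoe⟩)) t ht (hr.mono ?_)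
          exact openGraph_mono fun e he => ⟨he.1, fun hb => he.2 (barOf_mono {v} hKK' hb)⟩
        simp only [if_pos ha, if_pos ha', le_refl]
      · rw [if_neg ha]; positivity
    · rw [if_neg ht, zero_mul]
      exact mul_nonneg (by positivity) (hq0 K')
  have hf1anti : Antitone f1 := by
    intro K K' hKK'
    simp only [hf1]
    by_cases h' : ∀ n ∈ N, ¬ (n = v ∨ ∃ e ∈ K', n ∈ e)
    · rw [if_pos h', if_pos (fun n hn hc => h' n hn (hc.imp id fun ⟨e, he, hne⟩ => ⟨e, hKK' he, hne⟩))]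
    · rw [if_neg h']; split_ifs <;> norm_num
  have hf2anti : Antitone f2 := by
    intro K K' hKK'
    simp only [hf2]
    by_cases h' : ∀ n ∈ N', ¬ (n = v ∨ ∃ e ∈ K', n ∈ e)
    · rw [if_pos h', if_pos (fun n hn hc => h' n hn (hc.imp id fun ⟨e, he, hne⟩ => ⟨e, hKK' he, hne⟩))]
    · rw [if_neg h']; split_ifs <;> norm_num
  -- reading `f1`, `f2` on configurations
  have hf1ω : ∀ ω : BondConfig V, f1 (openEdgeCluster ω v) = ({ω : BondConfig V | ∀ n ∈ N, ¬ (openGraph ω).Reachable v n}).indicator 1 ω := by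
    intro ω
    have e : (∀ n ∈ N, ¬ (n = v ∨ ∃ e ∈ openEdgeCluster ω v, n ∈ e)) ↔ ∀ n ∈ N, ¬ (openGraph ω).Reachable v n :=
      forall₂_congr fun n _ => not_congr (reachable_iff_exists_mem_openEdgeCluster ω v n).symm
    by_cases hω : ω ∈ {ω : BondConfig V | ∀ n ∈ N, ¬ (openGraph ω).Reachable v n}
    · simp only [hf1]; rw [if_pos (e.2 hω), indicator_of_mem hω, Pi.one_apply]
    · simp only [hf1]; rw [if_neg (fun h' => hω (e.1 h')), indicator_of_notMem hω]
  have hf2ω : ∀ ω : BondConfig V, f2 (openEdgeCluster ω v) = ({ω : BondConfig V | ∀ n ∈ N', ¬ (openGraph ω).Reachable v n}).indicator 1 ω := by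
    intro ω
    have e : (∀ n ∈ N', ¬ (n = v ∨ ∃ e ∈ openEdgeCluster ω v, n ∈ e)) ↔ ∀ n ∈ N', ¬ (openGraph ω).Reachable v n :=
      forall₂_congr fun n _ => not_congr (reachable_iff_exists_mem_openEdgeCluster ω v n).symm
    by_cases hω : ω ∈ {ω : BondConfig V | ∀ n ∈ N', ¬ (openGraph ω).Reachable v n}
    · simp only [hf2]; rw [if_pos (e.2 hω), indicator_of_mem hω, Pi.one_apply]
    · simp only [hf2]; rw [if_neg (fun h' => hω (e.1 h')), indicator_of_notMem hω]
  -- the four integrals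
  have iγ : ∫ ω in D, γ (openEdgeCluster ω v) ∂μ = μ.real E := by
    have h := setIntegral_obs_mul_eq_proj w S O v (fun _ => (1 : ℝ))
    simp only [mul_one] at h
    rw [← hD] at h
    rw [show (fun ω => γ (openEdgeCluster ω v)) = fun ω => (if (∃ o ∈ O, o = v ∨ ∃ e ∈ openEdgeCluster ω v, o ∈ e) then (1 : ℝ) else 0) *
          (∫ η, (if (∀ o ∈ O, ¬ (o = v ∨ ∃ e ∈ openEdgeCluster ω v, o ∈ e) →
              ∀ t ∈ S, ¬ (openGraph (η \ barOf {v} (openEdgeCluster ω v))).Reachable o t) then (1 : ℝ) else 0) ∂μ) from rfl,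
      ← h, setIntegral_indicator_one_eq]
    congr 1
    refine inter_eq_self_of_subset_right ?_
    rintro ω ⟨⟨o, ho, hov⟩, h2⟩ t ht hvt
    exact h2 o ho t ht (hov.trans hvt)
  have iγf1 : μ.real EN ≤ ∫ ω in D, γ (openEdgeCluster ω v) * f1 (openEdgeCluster ω v) ∂μ := by
    have h := setIntegral_obs_mul_eq_proj w S O v f1
    rw [← hD] at h
    have e : ∫ ω in D, γ (openEdgeCluster ω v) * f1 (openEdgeCluster ω v) ∂μ =
        ∫ ω in D, (E.indicator (1 : BondConfig V → ℝ) ω) * f1 (openEdgeCluster ω v) ∂μ := by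
      rw [h]
    rw [e, setIntegral_congr_fun (hmeas _) (fun ω _ => by rw [hf1ω, mul_comm]), setIntegral_mul_indicator_one,
      setIntegral_indicator_one_eq]
    refine measureReal_mono ?_ (measure_ne_top μ _)
    rintro ω ⟨⟨o, ho, hov⟩, h2⟩
    exact ⟨⟨fun t ht hvt => h2 o ho t (Finset.mem_union_left N ht) (hov.trans hvt), ⟨o, ho, hov⟩,
      fun o' ho' t ht => h2 o' ho' t (Finset.mem_union_left N ht)⟩,
      fun n hn hvn => h2 o ho n (Finset.mem_union_right S hn) (hov.trans hvn)⟩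
  have if2 : ∫ ω in D, f2 (openEdgeCluster ω v) ∂μ = μ.real {ω : BondConfig V | ∀ t ∈ S ∪ N', ¬ (openGraph ω).Reachable v t} := by
    rw [setIntegral_congr_fun (hmeas _) (fun ω _ => hf2ω ω), setIntegral_indicator_one_eq]
    congr 1; ext ω
    simp only [hD, mem_inter_iff, mem_setOf_eq, Finset.mem_union]
    exact ⟨fun ⟨h1, h2⟩ t ht => ht.elim (h1 t) (h2 t), fun h => ⟨fun t ht => h t (Or.inl ht), fun n hn => h n (Or.inr hn)⟩⟩
  have if12 : ∫ ω in D, f1 (openEdgeCluster ω v) * f2 (openEdgeCluster ω v) ∂μ =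
      μ.real {ω : BondConfig V | ∀ t ∈ S ∪ N ∪ N', ¬ (openGraph ω).Reachable v t} := by
    rw [setIntegral_congr_fun (hmeas _) (fun ω _ => by rw [hf1ω, hf2ω]), setIntegral_mul_indicator_one, setIntegral_indicator_one_eq]
    congr 1; ext ω
    simp only [hD, mem_inter_iff, mem_setOf_eq, Finset.mem_union]
    constructor
    · rintro ⟨⟨h1, h2⟩, h3⟩ t ht
      rcases ht with (ht | ht) | ht
      · exact h1 t ht
      · exact h3 t ht
      · exact h2 t ht
    · intro h
      exact ⟨⟨fun t ht => h t (Or.inl (Or.inl ht)), fun n hn => h n (Or.inr hn)⟩, fun n hn => h n (Or.inl (Or.inr hn))⟩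
  -- vdBHK Thm 1.3 for `C_v` given `v ↮ S`, twice
  have hvS' : v ∉ (↑S : Set V) := fun h => hvS (Finset.mem_coe.1 h)
  have hA := BHK2006_clusterConditionalPositiveAssociation.antitone_right BHK2006_clusterConditionalPositiveAssociation_holds V w v
    (↑S : Set V) γ f1 hγmono hf1anti hvS'
  have hB := BHK2006_clusterConditionalPositiveAssociation_holds V w v (↑S : Set V) (fun K => - f1 K) (fun K => - f2 K)
    (fun K K' h => neg_le_neg (hf1anti h)) (fun K K' h => neg_le_neg (hf2anti h)) hvS'
  simp only [mul_neg, neg_mul, integral_neg, neg_neg] at hB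
  rw [← hDX] at hA hB
  -- assemble
  have hDn : 0 ≤ μ.real D := hn D
  have hγ0 : 0 ≤ ∫ ω in D, γ (openEdgeCluster ω v) ∂μ := by rw [iγ]; exact hn E
  have hf20 : 0 ≤ ∫ ω in D, f2 (openEdgeCluster ω v) ∂μ := by rw [if2]; exact hn _
  rcases hDn.eq_or_lt with hD0 | hDpos
  · -- `μ(D) = 0`: the left-hand side vanishes
    have hEN0 : μ.real EN = 0 := by
      refine le_antisymm ((measureReal_mono ?_ (measure_ne_top μ _)).trans (le_of_eq hD0.symm)) (hn EN)
      rintro ω ⟨⟨o, ho, hov⟩, h2⟩ t ht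
      exact fun hvt => h2 o ho t (Finset.mem_union_left N ht) (hov.trans hvt)
    rw [hEN0, zero_mul]
    exact mul_nonneg (hn _) (hn _)
  · have s1 : μ.real EN * (∫ ω in D, f2 (openEdgeCluster ω v) ∂μ) * μ.real D ≤
        (∫ ω in D, γ (openEdgeCluster ω v) * f1 (openEdgeCluster ω v) ∂μ) * (∫ ω in D, f2 (openEdgeCluster ω v) ∂μ) * μ.real D :=
      mul_le_mul_of_nonneg_right (mul_le_mul_of_nonneg_right iγf1 hf20) hDn
    have s2 : (∫ ω in D, γ (openEdgeCluster ω v) * f1 (openEdgeCluster ω v) ∂μ) * (∫ ω in D, f2 (openEdgeCluster ω v) ∂μ) * μ.real D ≤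
        (∫ ω in D, γ (openEdgeCluster ω v) ∂μ) * (∫ ω in D, f1 (openEdgeCluster ω v) ∂μ) * (∫ ω in D, f2 (openEdgeCluster ω v) ∂μ) := by
      have := mul_le_mul_of_nonneg_right hA hf20
      linarith [this]
    have s3 : (∫ ω in D, γ (openEdgeCluster ω v) ∂μ) * (∫ ω in D, f1 (openEdgeCluster ω v) ∂μ) * (∫ ω in D, f2 (openEdgeCluster ω v) ∂μ) ≤
        (∫ ω in D, γ (openEdgeCluster ω v) ∂μ) * (∫ ω in D, f1 (openEdgeCluster ω v) * f2 (openEdgeCluster ω v) ∂μ) * μ.real D := by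
      have := mul_le_mul_of_nonneg_left hB hγ0
      linarith [this]
    rw [← if2, ← iγ, ← if12]
    exact le_of_mul_le_mul_right ((s1.trans s2).trans s3) hDpos

end SetSurplus

end Summit.CriticalPhenomena.PercolationContinuityZ3.Theorems

end
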